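import Literature.AnabelianGeometry.AbsoluteAnabelian.FundamentalExtension
import Literature.AnabelianGeometry.AbsoluteAnabelian.AbsTopIII.KummerFaithful
import Literature.NumberTheory.DiophantineGeometry.FunctionFieldGenus
import Literature.AlgebraicGeometry.Frobenioids.Categories
import HarnessLib

/-!
# [AbsTopIII] §1, Theorem 1.11: semi-absolute reconstruction of function fields (a closed fact)

Mochizuki, *Topics in Absolute Anabelian Geometry III*, §1, Theorem 1.11 ("Semi-absolute
Reconstruction of Function Fields of Curves over Kummer-faithful Fields") pp. 45–47 and Remarks
1.11.1–1.11.5 pp. 47–49 of the author's manuscript (lit key `paper:url-5493eb38cbb7`; journal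
pagination not held).

"Let `X` be a smooth, proper, geometrically connected curve of genus `g_X` over a Kummer-faithful
field `k`; `K_X` the function field of `X`; `η_X := Spec(K_X)`; `k̄` an algebraic closure of `k`;
`1 → Δ_{η_X} → Π_{η_X} → G_k → 1` — where `Π_{η_X} := π₁(η_X) → G_k := Gal(k̄/k)` denotes the
natural surjection [...]. Then `Δ_{η_X}`, `Π_{η_X}`, and `G_k` are slim. [...] suppose further
[...] that `g_X ≥ 2`. Then there exists a functorial 'group-theoretic' algorithm for
reconstructing the function field `K_X` from the extension of profinite groups
`1 → Δ_{η_X} → Π_{η_X} → G_k → 1`" (p. 45–46).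

## Why this theorem is a CLOSED fact (unlike Thm. 1.9 / Cor. 1.10)

The input here is BIRATIONAL: `Π_{η_X} = π₁(Spec K_X) = Gal(K̄_X/K_X)` is the absolute Galois
group of the function field, and `Π_{η_X} → G_k` is the restriction map — both REAL in the tree
(`Field.absoluteGaloisGroup`, `Literature.NumberTheory.GaloisRepresentations.absGaloisRestrict`).
So the input extension `genericPointExtension k K` is constructed, the target `K` is the given
function field, and "there exists a functorial group-theoretic algorithm reconstructing `K_X`"
is typed junk-free and non-vacuously as: some `FunctionFieldAlgorithm` (outputs for ALL abstract
extensions + transport along isomorphisms; Rmk. 1.9.8 p. 40) returns, on every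
`genericPointExtension k K` with `k` Kummer-faithful and `g ≥ 2`, a pair `k' ⊆ K'` isomorphic to
`k ⊆ K`.  The surjectivity of `Gal(K̄/K) → Gal(k̄/k)` (true since `k` is algebraically closed in
`K`) is carried as an explicit hypothesis.  Steps (a)–(d) of the algorithm (the cyclotomic
character via `F_{χ_l}`, the genus formula and the inertia/decomposition groups, `I_x ≅ M_X` and
`P_{η_X}`, the Kummer image and Prop. 1.3) are quoted in the docstrings; (b)'s "decomposition
group = normalizer of inertia" is the interface predicate `CuspidalData.DecompEqNormalizer`.
Slimness is the tree's `Literature.AlgebraicGeometry.Frobenioids.IsSlimGroup` ([FrdI] §0 p. 13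
= [AbsTopI] §0 p. 8).  `IsKummerFaithful` carries a `TODO(general form)` (semi-abelian
varieties, see `KummerFaithful.lean`): as a HYPOTHESIS here it is formally weaker than print,
so the facts `Thm_1_11`, `Thm_1_11_slim` as typed are formally STRONGER than print until that
TODO is closed — recorded, not hidden; the printed proof uses Kummer-faithfulness only through
`𝔾_m` and Jacobians (Prop. 1.6), which the present predicate covers.
-/

noncomputable section

open CategoryTheory
open scoped Classical

namespace Literature.AnabelianGeometry.AbsoluteAnabelian.AbsTopIII

open Literature.NumberTheory.GaloisRepresentations (absGaloisRestrict)
open Literature.NumberTheory.DiophantineGeometry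
open Literature.NumberTheory.DiophantineGeometry.AlgFunctionField
open Literature.AlgebraicGeometry.Frobenioids (IsSlimGroup)

universe u

/-! ### The input: the extension attached to the generic point (REAL) -/

/-- The extension "`1 → Δ_{η_X} → Π_{η_X} → G_k → 1`" of Thm. 1.11 p. 45 for the function field
`K = K_X` over `k`, as a genuine `FundamentalExtension`: `Π_{η_X} = Gal(K̄/K)`,
`G_k = Gal(k̄/k)`, augmentation = restriction along `k ⊆ K` (the tree's `absGaloisRestrict`),
whose surjectivity (`k` algebraically closed in `K`) is the hypothesis `hsurj`.
[cite: MochizukiAbsTopIII2015, Thm 1.11 p.45] -/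
def genericPointExtension (k K : Type u) [Field k] [CharZero k] [Field K] [CharZero K]
    [Algebra k K] (hsurj : Function.Surjective (absGaloisRestrict k K)) :
    FundamentalExtension.{u} where
  arith := absoluteGaloisGrp K
  gal := absoluteGaloisGrp k
  aug := absGaloisRestrict k K
  aug_surjective := hsurj

/-! ### Output signature and algorithm -/

/-- OUTPUT SIGNATURE of Thm. 1.11 over an abstract extension `E`: (d) "the additive structure on
`K_X^× ∪ {0}`" — a field `functionField` with its subfield of constants `baseField`
("`k^× ⊆ K_X^×` may be constructed as the intersection `⋂_v Ker(v)`", Prop. 1.3 proof p. 30) —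
together with (c)/(d) the Kummer container "`H¹(Π_{η_X}, M_X)`" as an abstract group and the
injective Kummer map, and (b) the inertia and decomposition groups of the points `x ∈ X(k̄)` as
sets of subgroups of `Π`. [cite: MochizukiAbsTopIII2015, Thm 1.11 (d) p.47] -/
structure FunctionFieldReconstruction (E : FundamentalExtension.{u}) : Type (u + 1) where
  /-- the constant field `k` -/
  baseField : Type u
  /-- field structure -/
  [instBaseField : Field baseField]
  /-- (d) "`K_X^× ∪ {0}`" with its additive structure -/
  functionField : Type u
  /-- field structure -/
  [instFunctionField : Field functionField]
  /-- `k ⊆ K_X` -/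
  [instAlgebra : Algebra baseField functionField]
  /-- (c) the Kummer container "`H¹(Π_{η_X}, M_X)`" (multiplicative notation) -/
  H1 : Type u
  /-- abelian group structure -/
  [instH1 : CommGroup H1]
  /-- (d) "the image of the Kummer map `K_X^× → H¹(Π_{η_X}, M_X)`" -/
  kummer : functionFieldˣ →* H1
  /-- injectivity of the Kummer map (Prop. 1.6 (i)) -/
  kummer_injective : Function.Injective kummer
  /-- (b) "the inertia subgroups `I_x ⊆ Δ_{η_X}` of points `x ∈ X(k̄)`" -/
  inertiaSubgroups : Set (Subgroup E.arith)
  /-- (b) "the decomposition group `D_x ⊆ Π_{η_X}` [...] the normalizer [...] of `I_x`" -/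
  decompSubgroups : Set (Subgroup E.arith)
  /-- (b) every decomposition group is the normalizer of an inertia group -/
  decomp_eq : decompSubgroups = {D | ∃ I ∈ inertiaSubgroups, D = Subgroup.normalizer (I : Set E.arith)}

attribute [instance] FunctionFieldReconstruction.instBaseField
  FunctionFieldReconstruction.instFunctionField FunctionFieldReconstruction.instAlgebra
  FunctionFieldReconstruction.instH1

/-- Isomorphisms of Thm.-1.11 outputs (for functoriality): field isomorphisms compatible with
`k ⊆ K_X`. [cite: MochizukiAbsTopIII2015, Thm 1.11 p.47] -/
structure FunctionFieldReconstruction.Iso {E F : FundamentalExtension.{u}}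
    (P : FunctionFieldReconstruction E) (Q : FunctionFieldReconstruction F) : Type u where
  /-- on `k` -/
  baseEquiv : P.baseField ≃+* Q.baseField
  /-- on `K_X` -/
  funEquiv : P.functionField ≃+* Q.functionField
  /-- compatibility with `k ⊆ K_X` -/
  comm : ∀ c, funEquiv (algebraMap P.baseField P.functionField c) =
    algebraMap Q.baseField Q.functionField (baseEquiv c)

/-- The "functorial 'group-theoretic' ALGORITHM" of Thm. 1.11: outputs on ALL abstract extensions
and transport along isomorphisms ("the asserted 'functoriality' is with respect to arbitrary open
injective homomorphisms of extensions of profinite groups [cf. Remark 1.10.1, (i)]", p. 47 — the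
isomorphism part is typed). [cite: MochizukiAbsTopIII2015, Thm 1.11 p.45] -/
structure FunctionFieldAlgorithm : Type (u + 2) where
  /-- the output on an abstract extension -/
  obj : ∀ E : FundamentalExtension.{u}, FunctionFieldReconstruction E
  /-- transport along isomorphisms of extensions -/
  map : ∀ {E F : FundamentalExtension.{u}}, (E ≅ F) → (obj E).Iso (obj F)
  /-- functoriality: identities -/
  map_id : ∀ E, (map (Iso.refl E)).funEquiv = RingEquiv.refl _
  /-- functoriality: composition -/
  map_comp : ∀ {E F K : FundamentalExtension.{u}} (e : E ≅ F) (f : F ≅ K),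
    (map (e ≪≫ f)).funEquiv = (map e).funEquiv.trans (map f).funEquiv
  /-- functoriality "with respect to arbitrary open injective homomorphisms of extensions of
  profinite groups [cf. Remark 1.10.1, (i)]" (p. 47; finite separable extensions of the function
  field): the induced embedding of reconstructed function fields, contravariant -/
  comap : ∀ {E F : FundamentalExtension.{u}} (f : E ⟶ F), f.IsOpenInjective →
    ((obj F).functionField →+* (obj E).functionField)
  /-- on an isomorphism, `comap` inverts `map` -/
  comap_map : ∀ {E F : FundamentalExtension.{u}} (e : E ≅ F) (h : (e.hom).IsOpenInjective)
    (x : (obj E).functionField), comap e.hom h ((map e).funEquiv x) = x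

/-! ### Theorem 1.11 -/

/-- Thm. 1.11, slimness: "Then `Δ_{η_X}`, `Π_{η_X}`, and `G_k` are slim" — for `K/k` the
function field of a smooth proper geometrically connected curve over a Kummer-faithful field `k`
(any genus), with `Gal(K̄/K) → Gal(k̄/k)` surjective.  CLOSED NAMED FACT (hypothesis
`IsKummerFaithful` carries a TODO(general form), see the module docstring).
[cite: MochizukiAbsTopIII2015, Thm 1.11 p.45] -/
def Thm_1_11_slim : Prop :=
  ∀ (k K : Type u) [Field k] [CharZero k] [Field K] [CharZero K] [Algebra k K]
    [IsAlgFunctionField k K] [IsIntegrallyClosedIn k K]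
    (hsurj : Function.Surjective (absGaloisRestrict k K)), IsKummerFaithful k →
      IsSlimGroup (Field.absoluteGaloisGroup K)
        ∧ IsSlimGroup (genericPointExtension k K hsurj).geom
        ∧ IsSlimGroup (Field.absoluteGaloisGroup k)

/-- Thm. 1.11, reconstruction: for `g_X ≥ 2`, "there exists a functorial 'group-theoretic'
algorithm for reconstructing the function field `K_X` from the extension of profinite groups
`1 → Δ_{η_X} → Π_{η_X} → G_k → 1`; this algorithm consists of the following steps: (a) [...] the
power-equivalence class of the cyclotomic character `χ_l : G_k → ℤ_l^×` may be characterized by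
the condition that `F_{χ_l}(Δ^ab_{η_X} ⊗ ℤ_l)` is not topologically finitely generated. (b) [...]
one may compute the genus of `X` via the formula `2 g_X = dim_{ℚ_l}(Q(Δ^ab ⊗ ℤ_l) ⊗ ℚ_l) +
dim_{ℚ_l}(T(Δ^ab ⊗ ℤ_l) ⊗ ℚ_l)` [...] a 'group-theoretic' characterization of the inertia
subgroups `I_x` [...] the decomposition group `D_x` [...] as the normalizer [...] of `I_x`.
(c) [...] the natural isomorphisms `I_x ≅ M_X` [...] `P_{η_X} ⊆ H¹(Π_{η_X}, M_X)` [...] the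
principal divisors. (d) The image of the Kummer map `K_X^× → H¹(Π_{η_X}, M_X)` [...] the additive
structure on `K_X^× ∪ {0}` may be recovered via the algorithm of Proposition 1.3."  TYPED as the
existence of a `FunctionFieldAlgorithm` whose output on every `genericPointExtension k K`
(`k` Kummer-faithful, `genus k K ≥ 2`) is isomorphic to `k ⊆ K`.  CLOSED NAMED FACT (hypothesis
`IsKummerFaithful`: TODO(general form), see the module docstring).
[cite: MochizukiAbsTopIII2015, Thm 1.11 p.46] -/
def Thm_1_11 : Prop :=
  ∃ A : FunctionFieldAlgorithm.{u},
    ∀ (k K : Type u) [Field k] [CharZero k] [Field K] [CharZero K] [Algebra k K]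
      [IsAlgFunctionField k K] [IsIntegrallyClosedIn k K]
      (hsurj : Function.Surjective (absGaloisRestrict k K)),
      IsKummerFaithful k → 2 ≤ genus k K →
        ∃ (eb : (A.obj (genericPointExtension k K hsurj)).baseField ≃+* k)
          (ef : (A.obj (genericPointExtension k K hsurj)).functionField ≃+* K),
          ∀ c, ef (algebraMap _ _ c) = algebraMap k K (eb c)

/-- Thm. 1.11, bi-anabelian shadow (the "functoriality with respect to isomorphisms" portion,
i.e. the anabelian comparison statement for function fields, cf. Rmk. 1.9.5 (i) p. 39 and
Rmk. 1.11.1 (ii) p. 47): an isomorphism of the extensions attached to two such function fields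
induces an isomorphism of the function fields over an isomorphism of the constant fields.
PROVED from `Thm_1_11` by transporting along `FunctionFieldAlgorithm.map` (consumers take
`(h : Thm_1_11)`). [cite: MochizukiAbsTopIII2015, Thm 1.11 p.46] -/
theorem Thm_1_11_isom (h : Thm_1_11.{u}) :
    ∀ (k K : Type u) [Field k] [CharZero k] [Field K] [CharZero K] [Algebra k K]
      [IsAlgFunctionField k K] [IsIntegrallyClosedIn k K]
      (hsurj : Function.Surjective (absGaloisRestrict k K))
      (k' K' : Type u) [Field k'] [CharZero k'] [Field K'] [CharZero K'] [Algebra k' K']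
      [IsAlgFunctionField k' K'] [IsIntegrallyClosedIn k' K']
      (hsurj' : Function.Surjective (absGaloisRestrict k' K')),
      IsKummerFaithful k → IsKummerFaithful k' → 2 ≤ genus k K → 2 ≤ genus k' K' →
        Nonempty (genericPointExtension k K hsurj ≅ genericPointExtension k' K' hsurj') →
          ∃ (eb : k ≃+* k') (ef : K ≃+* K'),
            ∀ c, ef (algebraMap k K c) = algebraMap k' K' (eb c) := by
  intro k K _ _ _ _ _ _ _ hsurj k' K' _ _ _ _ _ _ _ hsurj' hk hk' hg hg' he
  obtain ⟨e⟩ := he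
  obtain ⟨A, hA⟩ := h
  obtain ⟨eb, ef, hc⟩ := hA k K hsurj hk hg
  obtain ⟨eb', ef', hc'⟩ := hA k' K' hsurj' hk' hg'
  refine ⟨eb.symm.trans ((A.map e).baseEquiv.trans eb'), ef.symm.trans ((A.map e).funEquiv.trans ef'),
    fun c => ?_⟩
  have h1 : ef.symm (algebraMap k K c) = algebraMap _ _ (eb.symm c) := by
    apply ef.injective
    rw [RingEquiv.apply_symm_apply, hc, RingEquiv.apply_symm_apply]
  simp only [RingEquiv.trans_apply]
  rw [h1, (A.map e).comm, hc']

/-! ### Remarks 1.11.1–1.11.5 (records)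

* Rmk. 1.11.1 (i) p. 47: "when `k` is an MLF, the semi-absolute algorithms of Theorem 1.11 may be
  rendered absolute [i.e., one may construct the kernel of the quotient `Π_{η_X} ↠ G_k`]" — typed
  below as `Rmk_1_11_1_i` (closed: absolute Galois groups of function fields over MLF's determine
  `Δ_{η_X}`).  (ii): over an NF, [Pop] Thm. 2 gives an absolute version — record.
* Rmk. 1.11.2 p. 47–48 (the role of the moduli of curves as a "functorial group-theoretically
  reconstructible embedding"), Rmk. 1.11.3 p. 48 ("the techniques [...] of Theorem 1.11 are
  extremely elementary [...] do not depend on [...] `p`-adic Hodge theory"), Rmk. 1.11.4 (i)–(ii)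
  p. 48–49 ("'most' hyperbolic curves admit a core [...] 'function fields do not admit cores':
  `Loc(η_X)` fails to admit a terminal object"), Rmk. 1.11.5 p. 49 (affine curves = function
  field + finitely many conjugacy classes of inertia groups) — discussion; no further decls.
-/

/-- Rmk. 1.11.1 (i) p. 47: "when `k` is an MLF, the semi-absolute algorithms of Theorem 1.11 may
be rendered absolute [i.e., one may construct the kernel of the quotient '`Π_{η_X} ↠ G_k`']" —
TYPED as: for function fields of genus `≥ 2` over MLF's, every isomorphism of the profinite
groups `Gal(K̄/K) ≅ Gal(K̄'/K')` carries `Δ_{η_X}` onto `Δ_{η_{X'}}`.  CLOSED NAMED FACT.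
[cite: MochizukiAbsTopIII2015, Rmk 1.11.1 (i) p.47] -/
def Rmk_1_11_1_i : Prop :=
  ∀ (k K : Type u) [Field k] [CharZero k] [Field K] [CharZero K] [Algebra k K]
    [IsAlgFunctionField k K] [IsIntegrallyClosedIn k K]
    (hsurj : Function.Surjective (absGaloisRestrict k K))
    (k' K' : Type u) [Field k'] [CharZero k'] [Field K'] [CharZero K'] [Algebra k' K']
    [IsAlgFunctionField k' K'] [IsIntegrallyClosedIn k' K']
    (hsurj' : Function.Surjective (absGaloisRestrict k' K')),
    IsMLF k → IsMLF k' → 2 ≤ genus k K → 2 ≤ genus k' K' →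
      ∀ e : Field.absoluteGaloisGroup K ≃ₜ* Field.absoluteGaloisGroup K',
        (genericPointExtension k K hsurj).geom.map e.toMonoidHom =
          (genericPointExtension k' K' hsurj').geom

end Literature.AnabelianGeometry.AbsoluteAnabelian.AbsTopIII
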